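import Summits.QuantumAdvantage.AdviceFreeQNC0.TwistedTransfer
import HarnessLib

/-!
# `TwistBound p`: the twisted correlation bound of rung R11' — PROVED for every prime `p ≠ 3`

Planner qa-qnc0-p2 g15, ROUND-15 (p2) §3.11 step (ii) / `line15/Sketch15R7.lean` (def VERBATIM below): for an OBLIVIOUS firing set
`Y`, charge `c` and phase vector `β ∈ (ZMod p)ⁿ`, `|Σ_u e_p(Σ_{i : u_i} β_i)·[WIN_Y(u)]| ≤ 3√6·cos(π/(3p))^{#supp β}·2ⁿ`.
Proof: `TwistedTransfer.corr_win_le` (the twisted transfer calculus of the u-walk: `(−1)^N = 1 − 2[WIN]`, guess of the final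
state, per-site phase `ζ_i = e_p(β_i)`) reduces it to the per-site contraction `‖½(v(·+1) + e_p(a) v(·+2))‖₂ ≤ cos(π/(3p))‖v‖₂`
on `ℂ^{ℤ/3}` (`a ≠ 0`, `3 ∤ p`), which is qn-lit g18's `TwoModuli.sum_norm_sq_twistStep_three_le`
(`Literature/Computability/MetaComplexity/TwoModuliExpSums.lean`).  The constant obtained is `3 ≤ 3√6`.
WHAT THIS IS NOT: R11' itself (regularisation of the linear forms, character expansion, junta main term) is not here; the
bound is false for `p = 3` (`ρ₃ = 1`); separation NOT moved.
-/

noncomputable section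

namespace Summit.QuantumAdvantage.AdviceFreeQNC0

open Finset

/-- **`TwistBound p` from the per-site contraction** (the only trigonometric input, typed for the Literature by qn-lit:
`‖½(v(·+1) + e_p(a)·v(·+2))‖ ≤ cos(π/(3p))·‖v‖` on `ℂ^{ℤ/3}` for `a ≠ 0`, valid for primes `p ≠ 3`). -/
theorem twistBound_of_site (p : ℕ) [Fact p.Prime]
    (hsite : ∀ a : ZMod p, a ≠ 0 → ∀ v : ZMod 3 → ℂ,
      TwistedTransfer.cnsq (TwistedTransfer.twAvg (ZMod.stdAddChar a) v) ≤
        Real.cos (Real.pi / (3 * p)) ^ 2 * TwistedTransfer.cnsq v) :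
    ∀ (n c : ℕ) (Y : Finset (Fin (n + 1))) (β : Fin n → ZMod p),
      ‖∑ u : Fin n → Bool,
          (if ringWinU c (fun g _ => decide (g ∈ Y)) u = true then (1 : ℂ) else 0) *
            Complex.exp (2 * Real.pi * Complex.I * (((∑ i, if u i then β i else 0).val : ℝ) : ℂ) / (p : ℂ))‖
        ≤ 3 * Real.sqrt 6 * Real.cos (Real.pi / (3 * p)) ^ (Finset.univ.filter fun i => β i ≠ 0).card
            * (2 : ℝ) ^ n := by
  intro n c Y β
  have hp2 : 2 ≤ p := (Fact.out : p.Prime).two_le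
  have hcos : 0 ≤ Real.cos (Real.pi / (3 * p)) := by
    apply Real.cos_nonneg_of_neg_pi_div_two_le_of_le
    · have : 0 ≤ Real.pi / (3 * p) := by positivity
      linarith [Real.pi_pos]
    · rw [div_le_div_iff₀ (by positivity) (by norm_num)]
      have : (2 : ℝ) ≤ p := by exact_mod_cast hp2
      nlinarith [Real.pi_pos]
  have hchar : ∀ u : Fin n → Bool,
      Complex.exp (2 * Real.pi * Complex.I * (((∑ i, if u i then β i else 0).val : ℝ) : ℂ) / (p : ℂ)) =
        (ZMod.stdAddChar (∑ i : Fin n, if u i then β i else 0) : ℂ) := by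
    intro u
    rw [show (ZMod.stdAddChar (∑ i : Fin n, if u i then β i else 0) : ℂ) =
      (ZMod.toCircle (∑ i : Fin n, if u i then β i else 0) : ℂ) from rfl, ZMod.toCircle_apply]
    push_cast; ring_nf
  simp_rw [hchar]
  refine (TwistedTransfer.corr_win_le hcos hsite c Y β).trans ?_
  have h6 : (1 : ℝ) ≤ Real.sqrt 6 := by
    rw [show (1 : ℝ) = Real.sqrt 1 from Real.sqrt_one.symm]
    exact Real.sqrt_le_sqrt (by norm_num)
  have hpow : 0 ≤ Real.cos (Real.pi / (3 * p)) ^ (Finset.univ.filter fun i => β i ≠ 0).card * (2 : ℝ) ^ n := by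
    positivity
  nlinarith

/-- **`TwistBound p`** (planner qa-qnc0-p2 g15 Sketch15R7, verbatim): for an OBLIVIOUS firing set `Y`, charge `c` and a phase
vector `β ∈ (ZMod p)ⁿ`, `|Σ_u e_p(Σ_{i : u_i} β_i) · [WIN_Y(u)]| ≤ 3√6 · cos(π/(3p))^{#supp β} · 2ⁿ` — the only analytic input of
rung R11' (false for `p = 3`). -/
def TwistBound (p : ℕ) [Fact p.Prime] : Prop :=
  ∀ (n c : ℕ) (Y : Finset (Fin (n + 1))) (β : Fin n → ZMod p),
    ‖∑ u : Fin n → Bool,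
        (if ringWinU c (fun g _ => decide (g ∈ Y)) u = true then (1 : ℂ) else 0) *
          Complex.exp (2 * Real.pi * Complex.I * (((∑ i, if u i then β i else 0).val : ℝ) : ℂ) / (p : ℂ))‖
      ≤ 3 * Real.sqrt 6 * Real.cos (Real.pi / (3 * p)) ^ (Finset.univ.filter fun i => β i ≠ 0).card
          * (2 : ℝ) ^ n

/-- **`TwistBound p` — PROVED for every prime `p ≠ 3`** (per-site contraction = qn-lit g18's
`TwoModuli.sum_norm_sq_half_twistStep_three_le`, the sharp norm `cos(π/(3p))` of the one-bit twisted averaging operator). -/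
theorem twistBound (p : ℕ) [Fact p.Prime] (hp3 : p ≠ 3) : TwistBound p := by
  have hcop : p.Coprime 3 := (Nat.coprime_primes (Fact.out : p.Prime) Nat.prime_three).2 hp3
  refine twistBound_of_site p fun a ha v => ?_
  -- qn-lit's lemma on `ZMod 3 × Unit`, register ignored
  have h := Literature.Computability.MetaComplexity.TwoModuli.sum_norm_sq_twistStep_three_le hcop ha 1 2
    (X := Unit) (fun sx => v sx.1)
  rw [Fintype.sum_prod_type, Fintype.sum_prod_type] at h
  simp only [Finset.sum_const, Finset.card_univ, Fintype.card_unit, one_smul] at h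
  have hl : (∑ s : ZMod 3, ‖v (s + 1) + ZMod.stdAddChar a * v (s + 2)‖ ^ 2) =
      4 * TwistedTransfer.cnsq (TwistedTransfer.twAvg (ZMod.stdAddChar a) v) := by
    rw [show (∑ s : ZMod 3, ‖v (s + 1) + ZMod.stdAddChar a * v (s + 2)‖ ^ 2) =
      ‖v (0 + 1) + ZMod.stdAddChar a * v (0 + 2)‖ ^ 2 + ‖v (1 + 1) + ZMod.stdAddChar a * v (1 + 2)‖ ^ 2 +
      ‖v (2 + 1) + ZMod.stdAddChar a * v (2 + 2)‖ ^ 2 from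
      Fin.sum_univ_three (fun s : ZMod 3 => ‖v (s + 1) + ZMod.stdAddChar a * v (s + 2)‖ ^ 2)]
    unfold TwistedTransfer.cnsq TwistedTransfer.twAvg
    simp only [norm_div, Complex.norm_ofNat, div_pow]
    ring
  have hr : (∑ s : ZMod 3, ‖v s‖ ^ 2) = TwistedTransfer.cnsq v := Fin.sum_univ_three (fun s : ZMod 3 => ‖v s‖ ^ 2)
  rw [hl, hr] at h
  nlinarith [TwistedTransfer.cnsq_nonneg v, sq_nonneg (Real.cos (Real.pi / (3 * p)))]

end Summit.QuantumAdvantage.AdviceFreeQNC0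

end
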